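import Mathlib.RingTheory.Polynomial.Resultant.Basic
import Mathlib.RingTheory.Polynomial.GaussLemma
import Mathlib.RingTheory.Polynomial.UniqueFactorization
import Mathlib.RingTheory.Polynomial.RationalRoot
import Mathlib.RingTheory.Localization.FractionRing
import Literature.NumberTheory.DiophantineGeometry.PlaneCurveBezoutWeak
import HarnessLib

/-!
# No small polynomial vanishes on a truncated root of an irreducible `χ` (resultant argument)

Abstract form of the key step of Kaltofen's effective Hilbert irreducibility theorem as used by
Cafure–Matera (2006, §3.2, proof of Thm. 3.3: "the irreducibility of `χ` over `K̄(Z)[X, Y]`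
implies that the linear system (8) … has no solution"). Let `A` be a factorial domain and
`χ ∈ A[Y][X]` irreducible, of `X`-degree `δ` with unit leading coefficient, whose `X`-coefficients
have `Y`-degree `≤ d`. If `a ∈ A[Y]` is a root of `χ` to precision `Y^κ` (`Y^κ ∣ χ(a)`) and
`h ∈ A[Y][X]` has `X`-degree `< δ`, `X`-coefficients of `Y`-degree `≤ d`, and also
`Y^κ ∣ h(a)`, then `h = 0` as soon as `κ > (2δ - 1)d` (`eq_zero_of_pow_dvd_eval`).

Proof: the resultant `Res_X(χ, h) = pχ + qh ∈ A[Y]` has `Y`-degree `≤ (2δ-1)d < κ` (a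
`(2δ-1) × (2δ-1)` Sylvester determinant with entries of degree `≤ d`) and is divisible by `Y^κ`
(evaluate at `X = a`), so it vanishes; over the fraction field of `A[Y]` this makes `χ` and `h`
non-coprime, and `χ` being irreducible there (Gauss), `χ ∣ h`, contradicting `deg_X h < δ`.

## References

* E. Kaltofen, J. Comput. System Sci. 50 (1995) 274–295, §3 (proof of Thm. 5). [Kaltofen1995]
* A. Cafure, G. Matera, Finite Fields Appl. 12 (2006) 155–185, proof of Thm. 3.3. [CafureMatera2006]
-/

noncomputable section

open scoped Classical Polynomial
open Polynomial

namespace Literature.NumberTheory.DiophantineGeometry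

universe u

variable {A : Type u} [CommRing A]

/-! ### Degree of the resultant in the coefficients -/

/-- Entries of the Sylvester matrix have degree bounded by that of the coefficients (any
commutative coefficient ring; cf. `Dioph.natDegree_sylvester_le` for fields). [folklore] -/
theorem natDegree_sylvester_le' (F G : A[X][X]) (m n e : ℕ)
    (hF : ∀ i, (F.coeff i).natDegree ≤ e) (hG : ∀ i, (G.coeff i).natDegree ≤ e)
    (i j : Fin (m + n)) : (sylvester F G m n i j).natDegree ≤ e := by
  induction j using Fin.addCases with
  | left j => simp only [sylvester, Matrix.of_apply, Fin.addCases_left]; split_ifs <;> simp [hG]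
  | right j => simp only [sylvester, Matrix.of_apply, Fin.addCases_right]; split_ifs <;> simp [hF]

/-- **Degree of the resultant:** if all coefficients of `F, G ∈ A[Y][X]` have `Y`-degree `≤ e`
then `deg_Y Res_X^{m,n}(F, G) ≤ (m + n) e`. [folklore] -/
theorem natDegree_resultant_le (F G : A[X][X]) (m n e : ℕ)
    (hF : ∀ i, (F.coeff i).natDegree ≤ e) (hG : ∀ i, (G.coeff i).natDegree ≤ e) :
    (resultant F G m n).natDegree ≤ (m + n) * e := by
  rw [resultant]
  have := Dioph.natDegree_det_le_of_forall_le (sylvester F G m n) e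
    (natDegree_sylvester_le' F G m n e hF hG)
  simpa [Fintype.card_fin] using this

/-! ### Irreducibility over the fraction field of `A[Y]` -/

/-- An irreducible polynomial with unit leading coefficient over an integrally closed domain
stays irreducible over the fraction field (Gauss's lemma, non-monic form). [folklore] -/
theorem irreducible_map_fractionRing_of_isUnit_leadingCoeff {B : Type*} [CommRing B] [IsDomain B]
    [IsIntegrallyClosed B] {K : Type*} [Field K] [Algebra B K] [IsFractionRing B K]
    {χ : B[X]} (hirr : Irreducible χ) (hu : IsUnit χ.leadingCoeff) :
    Irreducible (χ.map (algebraMap B K)) := by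
  obtain ⟨c, hc⟩ := hu
  set χ' : B[X] := C (↑c⁻¹ : B) * χ with hχ'
  have hm : χ'.Monic := monic_C_mul_of_mul_leadingCoeff_eq_one (by rw [← hc, Units.inv_mul])
  have hirr' : Irreducible χ' := (irreducible_isUnit_mul (isUnit_C.2 (Units.isUnit c⁻¹))).2 hirr
  have hK := hm.irreducible_iff_irreducible_map_fraction_map (K := K) |>.1 hirr'
  rw [hχ', Polynomial.map_mul, map_C] at hK
  have hunit : IsUnit (C (algebraMap B K (↑c⁻¹ : B))) :=
    isUnit_C.2 ((Units.isUnit c⁻¹).map (algebraMap B K))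
  exact (irreducible_isUnit_mul hunit).1 hK

/-! ### The injectivity statement -/

/-- **No nonzero `h` of `X`-degree `< δ` vanishes to precision `Y^κ` on a truncated root of an
irreducible `χ`** (Kaltofen; Cafure–Matera, proof of Thm. 3.3). Let `A` be a factorial domain,
`χ ∈ A[Y][X]` irreducible with `deg_X χ = δ ≥ 1`, unit leading coefficient and `X`-coefficients
of `Y`-degree `≤ d`; let `h ∈ A[Y][X]` have `deg_X h ≤ δ - 1` and `X`-coefficients of `Y`-degree
`≤ d`; let `a ∈ A[Y]` with `Y^κ ∣ χ(a)` and `Y^κ ∣ h(a)`, where `κ > (2δ-1)d`. Then `h = 0`.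
[cite: Kaltofen1995, §3 (proof of Thm. 5)] [cite: CafureMatera2006, proof of Thm. 3.3] -/
theorem eq_zero_of_pow_dvd_eval [IsDomain A] [UniqueFactorizationMonoid A]
    {χ h : A[X][X]} {δ d κ : ℕ} (hδ : 1 ≤ δ) (hχdeg : χ.natDegree = δ)
    (hχu : IsUnit χ.leadingCoeff) (hχirr : Irreducible χ)
    (hχc : ∀ i, (χ.coeff i).natDegree ≤ d) (hhdeg : h.natDegree ≤ δ - 1)
    (hhc : ∀ i, (h.coeff i).natDegree ≤ d) (hκ : (2 * δ - 1) * d < κ)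
    {a : A[X]} (hχa : (X : A[X]) ^ κ ∣ χ.eval a) (hha : (X : A[X]) ^ κ ∣ h.eval a) : h = 0 := by
  by_contra hh0
  -- the resultant is a combination `p χ + q h`
  obtain ⟨p, q, -, -, hpq⟩ := exists_mul_add_mul_eq_C_resultant χ h (m := δ) (n := δ - 1)
    hχdeg.le hhdeg (Or.inl (by omega))
  set Res := resultant χ h δ (δ - 1) with hRes
  -- `Y^κ ∣ Res` by evaluation at `X = a`
  have hdvd : (X : A[X]) ^ κ ∣ Res := by
    have h1 := congrArg (Polynomial.eval a) hpq
    rw [eval_add, eval_mul, eval_mul, eval_C] at h1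
    rw [← h1]
    exact dvd_add (hχa.mul_right _) (hha.mul_right _)
  -- the degree bound forces `Res = 0`
  have hRes0 : Res = 0 := by
    refine Polynomial.eq_zero_of_dvd_of_natDegree_lt hdvd ?_
    rw [natDegree_X_pow]
    calc Res.natDegree ≤ (δ + (δ - 1)) * d := natDegree_resultant_le χ h δ (δ - 1) d hχc hhc
      _ < κ := by rwa [show δ + (δ - 1) = 2 * δ - 1 by omega]
  -- pass to the fraction field of `A[Y]`
  set K := FractionRing A[X] with hK
  have hinj : Function.Injective (algebraMap A[X] K) := IsFractionRing.injective _ _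
  have hmap := resultant_map_map χ h δ (δ - 1) (algebraMap A[X] K)
  rw [← hRes, hRes0, map_zero] at hmap
  set χK := χ.map (algebraMap A[X] K) with hχK
  set hK' := h.map (algebraMap A[X] K) with hhK'
  have hK0 : hK' ≠ 0 := (Polynomial.map_ne_zero_iff hinj).2 hh0
  have hχKdeg : χK.natDegree = δ := by rw [hχK, natDegree_map_eq_of_injective hinj, hχdeg]
  have hhKdeg : hK'.natDegree ≤ δ - 1 := by
    rw [hhK', natDegree_map_eq_of_injective hinj]; exact hhdeg
  -- remove the degree padding
  obtain ⟨k, hk⟩ : ∃ k, δ - 1 = hK'.natDegree + k := ⟨δ - 1 - hK'.natDegree, by omega⟩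
  rw [hk, resultant_add_right_deg _ _ _ _ k le_rfl] at hmap
  have hχK0 : χK ≠ 0 := fun h0 ↦ by rw [h0, natDegree_zero] at hχKdeg; omega
  have hlc : χK.coeff δ ≠ 0 := by
    rw [← hχKdeg, coeff_natDegree]
    exact leadingCoeff_ne_zero.2 hχK0
  have hres0 : resultant χK hK' δ hK'.natDegree = 0 :=
    (mul_eq_zero.1 hmap).resolve_left (pow_ne_zero _ hlc)
  rw [← hχKdeg] at hres0
  have hncop : ¬ IsCoprime χK hK' := (resultant_eq_zero_iff.1 hres0).2
  have hirrK : Irreducible χK := irreducible_map_fractionRing_of_isUnit_leadingCoeff hχirr hχu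
  have hdvdK : χK ∣ hK' := by
    by_contra hnd
    exact hncop (hirrK.coprime_iff_not_dvd.2 hnd)
  have := natDegree_le_of_dvd hdvdK hK0
  omega

end Literature.NumberTheory.DiophantineGeometry
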